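import Mathlib
import Summits.RiemannHypothesis.RiemannHypothesis.Theorems.WeilGroundStateGroundStateSimpleEvenStubParabolaEnergy
import Summits.RiemannHypothesis.RiemannHypothesis.Theorems.WeilGroundStateGroundStateSimpleEvenStubParabolaRayleigh
import Summits.RiemannHypothesis.RiemannHypothesis.Theorems.WeilGroundStateGroundStateSimpleEvenStubArchTail
import Summits.RiemannHypothesis.RiemannHypothesis.Theorems.WeilGroundStateGroundStateSimpleEvenStubArchTailBound
import Summits.RiemannHypothesis.RiemannHypothesis.Theorems.WeilGroundStateGroundStateSimpleEvenStubMarkovConstant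
import Summits.RiemannHypothesis.RiemannHypothesis.Theorems.WeilGroundStateGroundStateSimpleEvenStubHyperbolicBounds
import Literature.NumberTheory.LFunctions.WeilExplicit
import HarnessLib

/-!
# Crux `GroundStateSimpleEven` (stmt-RiemannHypothesis-1526), line `parity-multiplicity-commutator` v3:
# the even upper bound — the parabola's Rayleigh quotient in closed form (E-free)

Support file (`--supports stmt-RiemannHypothesis-1526`) of the lead's stub `stub_archimedeanWindows`
(the crux on every archimedean window `0 < a ≤ (log 2)/2`, by the Fourier bathtub for the odd
sector against the parabola's Rayleigh quotient).
For `0 < b ≤ (log 2)/2`: `ε(b) ≤ −log b + (π/2 + log 2 + (15/16)(248/225) − 5.3716) + (35/12)b + b²/12 + (11/30)b³ + (3/1000)b⁵`, from the parabolic bump (`stub_parabolaIncrementEnergy`, `stub_parabolaRayleigh`), the closed form of the tail of the jump density (`stub_archTail`, `stub_archTailBound`), the killing constant (`stub_markovConstant_ge`) and the hyperbolic bound of the pole term (`stub_hyperbolicBounds`).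
Everything is GENERIC in the cap `E : ℝ → ℝ`: its values on the 27 pieces (the Taylor polynomial
`2u²/3 − 2u⁴/15 + 4u⁶/315` on `(0, 7/5]`, certified constants on 24 panels with 7-smooth rational
ends up to `16/5`, `1` on `(16/5, 47/10]`, `2` beyond, `1` at `u ≤ 0`) and its measurability are
SECTION HYPOTHESES, included where used; the cap itself is constructed once, in
`…ArchCapExists.lean`.  Generated mechanically from the certified table of the lead's folder
(`work/numerics/final_design.py`, `gen2.py`); every constant is re-checked by the kernel.
-/

noncomputable section

open Set MeasureTheory Filter
open Literature.NumberTheory.LFunctions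
open scoped Real Topology

namespace Summit.RiemannHypothesis.RiemannHypothesis.Theorems.GroundStateSimpleEven


set_option linter.dupNamespace false in
/-- **Even upper bound by the parabola.** [folklore] -/
theorem arch_evenUpper : ∀ b : ℝ, 0 < b → b ≤ Real.log 2 / 2 →
        weilGroundEnergy b ≤ -Real.log b + (Real.pi / 2 + Real.log 2 + 15 / 16 * (248 / 225) - 5.3716) + (35 / 12 * b + b ^ 2 / 12 + 11 / 30 * b ^ 3 + 3 / 1000 * b ^ 5) := by
  intro b hb hbl
  have hl2 := Real.log_two_lt_d9
  have hb1 : b ≤ 1 := by linarith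
  obtain ⟨hn, hinc, hint, hin⟩ := Summit.RiemannHypothesis.RiemannHypothesis.Theorems.stub_parabolaIncrementEnergy b hb
  obtain ⟨htail, hT⟩ := Summit.RiemannHypothesis.RiemannHypothesis.Theorems.stub_archTail b hb
  have hR := Summit.RiemannHypothesis.RiemannHypothesis.Theorems.stub_parabolaRayleigh b hb hbl hn hinc hint hin htail
  have hTB := Summit.RiemannHypothesis.RiemannHypothesis.Theorems.stub_archTailBound b hb hb1
  have hM := Summit.RiemannHypothesis.RiemannHypothesis.Theorems.stub_markovConstant_ge
  obtain ⟨hX0, hX1, -⟩ := Summit.RiemannHypothesis.RiemannHypothesis.Theorems.stub_hyperbolicBounds b hb.le hb1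
  rw [hT] at hR
  -- the pole term: 120/b⁵ · X² ≤ (10/3) b (1 + 3b²/100)²
  set X := 2 * b * Real.cosh (b / 2) - 4 * Real.sinh (b / 2) with hXdef
  have hX2 : X ^ 2 ≤ (b ^ 3 / 6 + b ^ 5 / 200) ^ 2 := pow_le_pow_left₀ hX0 hX1 2
  have hb5 : 0 < b ^ 5 := by positivity
  have hpole : 120 / b ^ 5 * X ^ 2 ≤ 10 / 3 * b * (1 + 3 * b ^ 2 / 100) ^ 2 := by
    have e : 10 / 3 * b * (1 + 3 * b ^ 2 / 100) ^ 2 = 120 / b ^ 5 * (b ^ 3 / 6 + b ^ 5 / 200) ^ 2 := by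
      field_simp
      ring
    rw [e]
    exact mul_le_mul_of_nonneg_left hX2 (by positivity)
  have hexp : 10 / 3 * b * (1 + 3 * b ^ 2 / 100) ^ 2 =
      10 / 3 * b + 1 / 5 * b ^ 3 + 3 / 1000 * b ^ 5 := by ring
  linarith


end Summit.RiemannHypothesis.RiemannHypothesis.Theorems.GroundStateSimpleEven

namespace Summit.RiemannHypothesis.RiemannHypothesis.Theorems

set_option linter.dupNamespace false in
/-- **Registered sub-goal**: the even upper bound of the bottom `ε(b)` by the parabolic bump, in closed form. [folklore] -/
theorem stub_archEvenUpper :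
    ∀ b : ℝ, 0 < b → b ≤ Real.log 2 / 2 →
        weilGroundEnergy b ≤ -Real.log b + (Real.pi / 2 + Real.log 2 + 15 / 16 * (248 / 225) - 5.3716) + (35 / 12 * b + b ^ 2 / 12 + 11 / 30 * b ^ 3 + 3 / 1000 * b ^ 5) := by
  exact GroundStateSimpleEven.arch_evenUpper

end Summit.RiemannHypothesis.RiemannHypothesis.Theorems
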